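import Summits.Ventures.CertifiedManyBodySolver.Downfold.EmeryShapeTrueCornerRule
import Summits.Ventures.CertifiedManyBodySolver.Downfold.EmeryFermiScalePointsLa214TrueCorners
import Summits.Ventures.CertifiedManyBodySolver.Downfold.EmeryFermiScalePointsLa214VirtualCorners
import Summits.Ventures.CertifiedManyBodySolver.Downfold.EmeryFermiScalePointsLa214Corners
import Summits.Ventures.CertifiedManyBodySolver.Downfold.EmeryBoxesCuprates
import HarnessLib

/-!
# THE ONE-BAND FERMI-SURFACE SHAPE `t′/t` OF THE WHOLE TYPED La₂CuO₄ 3BE BOX AT ITS TWO TRUE CORNERS (true-corner rule under certified margins, §B.87 (h))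

Venture CertifiedManyBodySolver, cell `pub/hubbard-downfold` (stage S1; INFLATION-RULES-3to1-B §B.87 (h)), seat hubbard-downfold-mod-4 (technique B, g35); namespace
`Summit.Ventures.CertifiedManyBodySolver.Downfold.Emery`. Everything PROVED (0 sorry). WHAT THIS IS NOT: a statement about La₂CuO₄ — the typed box `emeryBoxLa214` (box #18)
is SCREENING-GRADE; `U = 0` one-body kinematics of the σ model; object E = the EXACT `t–t′` shape of the σ Fermi surface at the row's own Fermi energy.

For EVERY one-body row `(Δ, t_pd, t_pp, t_pp′) ∈ [1.7, 4] × [1.29, 1.52] × [0.46, 0.66] × [0.12, 0.15]` eV the one-band `t′/t` lies between its values at the TRUE corners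
`(1.7, 1.29, 0.66, 0.15)` and `(4, 1.52, 0.46, 0.12)` (`EmeryShapeTrueCornerRule`: Δ- and t_pd-levers certificate-free; t_pp and t_pp′ by the MARGIN LEVERS of
`EmeryMarginLevers`, whose box-wide margins hold here with the factors printed below), read over their K = 384 brackets (`EmeryFermiScalePointsLa214TrueCorners`):

| filling | **true-corner window for t′/t (certified)** | margins lower slab (t_pp, t_pp′ channel: rhs/lhs) | upper slab | two-ray 1 piece (§B.86 (h)) | two-ray 3 pieces (§B.86 (j)) | g19 sub-box device | screening true corners |
|---|---|---|---|---|---|---|---|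

| x = 0 (ν = 1/2) | **[-0.2916, -0.1674]** | 2.55, free (dd ≤ 0) | 2.37, free (dd ≤ 0) | [−0.3091, −0.1583] | — | [−0.2955, −0.1653] | [−0.2915, −0.1675] |
| x = 1/8 (ν = 7/16) | **[-0.2926, -0.1681]** | 2.36, free (dd ≤ 0) | 2.32, free (dd ≤ 0) | [−0.3091, −0.1590] | [−0.2972, −0.1646] | [−0.2964, −0.1661] | [−0.2925, −0.1681] |
| x = 0.22 (ν = 39/100) | **[-0.2933, -0.1685]** | 2.28, free (dd ≤ 0) | 2.29, free (dd ≤ 0) | [−0.3093, −0.1595] | — | — | [−0.2932, −0.1685] |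

READING (value-free): the true-corner windows coincide with the screening true-corner values to ±10⁻⁴ — the 3 → 1 reduction of the SHAPE coordinate over this typed box is now
EXACT up to the point brackets (no device width left); they are tighter than the g19 sub-box device by 0.004 / 0.002 and than the two-ray window by 0.017 / 0.009.

Sources: three-band model [HybertsenSchluterChristensen1989, Eq. (1)]; [AndersenEtAl1995, §6]; box rows as cited in `EmeryBoxesCuprates`.
-/

noncomputable section

namespace Summit.Ventures.CertifiedManyBodySolver.Downfold.Emery

open Real Set

/-- **x = 0: for every row of the La₂CuO₄ 3BE box the one-band Fermi-surface `t′/t` lies in `[-0.2916, -0.1674]`** — its values at the two TRUE corners (margin levers; margins certified by `norm_num`). [folklore] -/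
theorem la214Box_fsRatio_true_x0 {Δ a b c : ℝ} (hΔ : Δ ∈ Icc ((17 : ℝ) / 10) 4) (ha : a ∈ Icc ((129 : ℝ) / 100) ((38 : ℝ) / 25)) (hb : b ∈ Icc ((23 : ℝ) / 50) ((33 : ℝ) / 50)) (hc : c ∈ Icc ((3 : ℝ) / 25) ((3 : ℝ) / 20)) :
    fsRatio Δ a b c (fermiEnergyOf Δ a b c ((1 : ℝ) / 2)) ∈ Icc ((-729 : ℝ) / 2500) ((-837 : ℝ) / 5000) := by
  have hSL := (fermiEnergyOf_of_pointBracketCheck truePt_la214SL_x0_br (by norm_num) (by norm_num) (by norm_num) (ν := (1/2 : ℝ)) (by push_cast; exact ⟨le_rfl, le_rfl⟩)).2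
  have hTL := (fermiEnergyOf_of_pointBracketCheck truePt_la214TL_x0_br (by norm_num) (by norm_num) (by norm_num) (ν := (1/2 : ℝ)) (by push_cast; exact ⟨le_rfl, le_rfl⟩)).2
  have hSU := (fermiEnergyOf_of_pointBracketCheck truePt_la214SU_x0_br (by norm_num) (by norm_num) (by norm_num) (ν := (1/2 : ℝ)) (by push_cast; exact ⟨le_rfl, le_rfl⟩)).2
  have hQU := (fermiEnergyOf_of_pointBracketCheck truePt_la214QU_x0_br (by norm_num) (by norm_num) (by norm_num) (ν := (1/2 : ℝ)) (by push_cast; exact ⟨le_rfl, le_rfl⟩)).2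
  have hTH := (fermiEnergyOf_of_pointBracketCheck truePt_la214TH_x0_br (by norm_num) (by norm_num) (by norm_num) (ν := (1/2 : ℝ)) (by push_cast; exact ⟨le_rfl, le_rfl⟩)).2
  have hAlo := (fermiEnergyOf_of_pointBracketCheck virtPt_la214Alo_x0_br (by norm_num) (by norm_num) (by norm_num) (ν := (1/2 : ℝ)) (by push_cast; exact ⟨le_rfl, le_rfl⟩)).2
  have hTop := (fermiEnergyOf_of_pointBracketCheck cornerPt_la214BoxHi_x0_br (by norm_num) (by norm_num) (by norm_num) (ν := (1/2 : ℝ)) (by push_cast; exact ⟨le_rfl, le_rfl⟩)).2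
  push_cast at hSL hTL hSU hQU hTH hAlo hTop
  norm_num at hSL hTL hSU hQU hTH hAlo hTop
  obtain ⟨hΔl, hΔu⟩ := hΔ
  obtain ⟨hal, hau⟩ := ha
  constructor
  · have hlow := fsRatio_fermiEnergyOf_trueCorner_lower (Δ₁ := (17 : ℝ) / 10) (a₁ := (129 : ℝ) / 100) (b₁ := (23 : ℝ) / 50) (b₂ := (33 : ℝ) / 50) (c₁ := (3 : ℝ) / 25) (c₂ := (3 : ℝ) / 20)
      (ν := ((1 : ℝ) / 2)) (pL := ((18641 : ℝ) / 10000)) (qL := ((9987 : ℝ) / 5000)) (Mb := ((14339 : ℝ) / 10000)) (Mc := (0 : ℝ)) (by norm_num) hΔl (by norm_num) hal (by norm_num) hb (by norm_num) hc (by norm_num) (by norm_num) (by norm_num)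
      (by norm_num) hSL.1 hAlo.2 (by norm_num) (by norm_num [fsD, fsN]) (by norm_num) (by norm_num) (by norm_num [fsD, fsN]) (by norm_num) (by norm_num [dopingDisc]) (by norm_num [fsD, fsN])
    refine le_trans ?_ hlow
    have hmono := (fsRatio_mem_Icc_on_window_of_dopingDisc_nonpos (Δ := (17 : ℝ) / 10) (a := (129 : ℝ) / 100) (b := (33 : ℝ) / 50) (c := (3 : ℝ) / 20)
      (p := ((9769 : ℝ) / 5000)) (q := ((2461 : ℝ) / 1250)) (by norm_num) (by norm_num) (by norm_num) (by norm_num) (by norm_num) (by norm_num) (by norm_num) (by norm_num [dopingDisc]) hTL).1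
    refine le_trans ?_ hmono
    norm_num [fsRatio, fsD, fsN]
  · have hup := fsRatio_fermiEnergyOf_trueCorner_upper (Δ₁ := (17 : ℝ) / 10) (Δ₂ := 4) (a₁ := (129 : ℝ) / 100) (a₂ := (38 : ℝ) / 25) (b₁ := (23 : ℝ) / 50) (b₂ := (33 : ℝ) / 50) (c₁ := (3 : ℝ) / 25) (c₂ := (3 : ℝ) / 20)
      (ν := ((1 : ℝ) / 2)) (pU := ((8097 : ℝ) / 5000)) (qU := ((17043 : ℝ) / 10000)) (qT := ((487 : ℝ) / 200)) (Mb := ((20011 : ℝ) / 5000)) (Mc := (0 : ℝ)) (by norm_num) ⟨hΔl, hΔu⟩ (by norm_num) ⟨hal, hau⟩ (by norm_num) hb (by norm_num) hc (by norm_num) (by norm_num) (by norm_num)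
      hTop.2 (by norm_num) (by norm_num) hSU.1 hQU.2 (by norm_num) (by norm_num [fsD, fsN]) (by norm_num) (by norm_num) (by norm_num [fsD, fsN]) (by norm_num) (by norm_num) (by norm_num [fsD, fsN])
    refine le_trans hup ?_
    have hmono := (fsRatio_mem_Icc_on_window_of_dopingDisc_nonpos (Δ := (4 : ℝ)) (a := (38 : ℝ) / 25) (b := (23 : ℝ) / 50) (c := (3 : ℝ) / 25)
      (p := ((2049 : ℝ) / 1250)) (q := ((4123 : ℝ) / 2500)) (by norm_num) (by norm_num) (by norm_num) (by norm_num) (by norm_num) (by norm_num) (by norm_num) (by norm_num [dopingDisc]) hTH).2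
    refine le_trans hmono ?_
    norm_num [fsRatio, fsD, fsN]

/-- **x = 1/8: for every row of the La₂CuO₄ 3BE box the one-band Fermi-surface `t′/t` lies in `[-0.2926, -0.1681]`** — its values at the two TRUE corners (margin levers; margins certified by `norm_num`). [folklore] -/
theorem la214Box_fsRatio_true_x0125 {Δ a b c : ℝ} (hΔ : Δ ∈ Icc ((17 : ℝ) / 10) 4) (ha : a ∈ Icc ((129 : ℝ) / 100) ((38 : ℝ) / 25)) (hb : b ∈ Icc ((23 : ℝ) / 50) ((33 : ℝ) / 50)) (hc : c ∈ Icc ((3 : ℝ) / 25) ((3 : ℝ) / 20)) :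
    fsRatio Δ a b c (fermiEnergyOf Δ a b c ((7 : ℝ) / 16)) ∈ Icc ((-1463 : ℝ) / 5000) ((-1681 : ℝ) / 10000) := by
  have hSL := (fermiEnergyOf_of_pointBracketCheck truePt_la214SL_x0125_br (by norm_num) (by norm_num) (by norm_num) (ν := (7/16 : ℝ)) (by push_cast; exact ⟨le_rfl, le_rfl⟩)).2
  have hTL := (fermiEnergyOf_of_pointBracketCheck truePt_la214TL_x0125_br (by norm_num) (by norm_num) (by norm_num) (ν := (7/16 : ℝ)) (by push_cast; exact ⟨le_rfl, le_rfl⟩)).2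
  have hSU := (fermiEnergyOf_of_pointBracketCheck truePt_la214SU_x0125_br (by norm_num) (by norm_num) (by norm_num) (ν := (7/16 : ℝ)) (by push_cast; exact ⟨le_rfl, le_rfl⟩)).2
  have hQU := (fermiEnergyOf_of_pointBracketCheck truePt_la214QU_x0125_br (by norm_num) (by norm_num) (by norm_num) (ν := (7/16 : ℝ)) (by push_cast; exact ⟨le_rfl, le_rfl⟩)).2
  have hTH := (fermiEnergyOf_of_pointBracketCheck truePt_la214TH_x0125_br (by norm_num) (by norm_num) (by norm_num) (ν := (7/16 : ℝ)) (by push_cast; exact ⟨le_rfl, le_rfl⟩)).2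
  have hAlo := (fermiEnergyOf_of_pointBracketCheck virtPt_la214Alo_x0125_br (by norm_num) (by norm_num) (by norm_num) (ν := (7/16 : ℝ)) (by push_cast; exact ⟨le_rfl, le_rfl⟩)).2
  have hTop := (fermiEnergyOf_of_pointBracketCheck cornerPt_la214BoxHi_x0125_br (by norm_num) (by norm_num) (by norm_num) (ν := (7/16 : ℝ)) (by push_cast; exact ⟨le_rfl, le_rfl⟩)).2
  push_cast at hSL hTL hSU hQU hTH hAlo hTop
  norm_num at hSL hTL hSU hQU hTH hAlo hTop
  obtain ⟨hΔl, hΔu⟩ := hΔ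
  obtain ⟨hal, hau⟩ := ha
  constructor
  · have hlow := fsRatio_fermiEnergyOf_trueCorner_lower (Δ₁ := (17 : ℝ) / 10) (a₁ := (129 : ℝ) / 100) (b₁ := (23 : ℝ) / 50) (b₂ := (33 : ℝ) / 50) (c₁ := (3 : ℝ) / 25) (c₂ := (3 : ℝ) / 20)
      (ν := ((7 : ℝ) / 16)) (pL := ((8689 : ℝ) / 5000)) (qL := ((3683 : ℝ) / 2000)) (Mb := ((1919 : ℝ) / 1250)) (Mc := (0 : ℝ)) (by norm_num) hΔl (by norm_num) hal (by norm_num) hb (by norm_num) hc (by norm_num) (by norm_num) (by norm_num)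
      (by norm_num) hSL.1 hAlo.2 (by norm_num) (by norm_num [fsD, fsN]) (by norm_num) (by norm_num) (by norm_num [fsD, fsN]) (by norm_num) (by norm_num [dopingDisc]) (by norm_num [fsD, fsN])
    refine le_trans ?_ hlow
    have hmono := (fsRatio_mem_Icc_on_window_of_dopingDisc_nonpos (Δ := (17 : ℝ) / 10) (a := (129 : ℝ) / 100) (b := (33 : ℝ) / 50) (c := (3 : ℝ) / 20)
      (p := ((1124 : ℝ) / 625)) (q := ((9067 : ℝ) / 5000)) (by norm_num) (by norm_num) (by norm_num) (by norm_num) (by norm_num) (by norm_num) (by norm_num) (by norm_num [dopingDisc]) hTL).1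
    refine le_trans ?_ hmono
    norm_num [fsRatio, fsD, fsN]
  · have hup := fsRatio_fermiEnergyOf_trueCorner_upper (Δ₁ := (17 : ℝ) / 10) (Δ₂ := 4) (a₁ := (129 : ℝ) / 100) (a₂ := (38 : ℝ) / 25) (b₁ := (23 : ℝ) / 50) (b₂ := (33 : ℝ) / 50) (c₁ := (3 : ℝ) / 25) (c₂ := (3 : ℝ) / 20)
      (ν := ((7 : ℝ) / 16)) (pU := ((1899 : ℝ) / 1250)) (qU := ((1579 : ℝ) / 1000)) (qT := ((2827 : ℝ) / 1250)) (Mb := ((20369 : ℝ) / 5000)) (Mc := (0 : ℝ)) (by norm_num) ⟨hΔl, hΔu⟩ (by norm_num) ⟨hal, hau⟩ (by norm_num) hb (by norm_num) hc (by norm_num) (by norm_num) (by norm_num)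
      hTop.2 (by norm_num) (by norm_num) hSU.1 hQU.2 (by norm_num) (by norm_num [fsD, fsN]) (by norm_num) (by norm_num) (by norm_num [fsD, fsN]) (by norm_num) (by norm_num) (by norm_num [fsD, fsN])
    refine le_trans hup ?_
    have hmono := (fsRatio_mem_Icc_on_window_of_dopingDisc_nonpos (Δ := (4 : ℝ)) (a := (38 : ℝ) / 25) (b := (23 : ℝ) / 50) (c := (3 : ℝ) / 25)
      (p := ((3079 : ℝ) / 2000)) (q := ((3099 : ℝ) / 2000)) (by norm_num) (by norm_num) (by norm_num) (by norm_num) (by norm_num) (by norm_num) (by norm_num) (by norm_num [dopingDisc]) hTH).2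
    refine le_trans hmono ?_
    norm_num [fsRatio, fsD, fsN]

/-- **x = 0.22: for every row of the La₂CuO₄ 3BE box the one-band Fermi-surface `t′/t` lies in `[-0.2933, -0.1685]`** — its values at the two TRUE corners (margin levers; margins certified by `norm_num`). [folklore] -/
theorem la214Box_fsRatio_true_x022 {Δ a b c : ℝ} (hΔ : Δ ∈ Icc ((17 : ℝ) / 10) 4) (ha : a ∈ Icc ((129 : ℝ) / 100) ((38 : ℝ) / 25)) (hb : b ∈ Icc ((23 : ℝ) / 50) ((33 : ℝ) / 50)) (hc : c ∈ Icc ((3 : ℝ) / 25) ((3 : ℝ) / 20)) :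
    fsRatio Δ a b c (fermiEnergyOf Δ a b c ((39 : ℝ) / 100)) ∈ Icc ((-2933 : ℝ) / 10000) ((-337 : ℝ) / 2000) := by
  have hSL := (fermiEnergyOf_of_pointBracketCheck truePt_la214SL_x022_br (by norm_num) (by norm_num) (by norm_num) (ν := (39/100 : ℝ)) (by push_cast; exact ⟨le_rfl, le_rfl⟩)).2
  have hTL := (fermiEnergyOf_of_pointBracketCheck truePt_la214TL_x022_br (by norm_num) (by norm_num) (by norm_num) (ν := (39/100 : ℝ)) (by push_cast; exact ⟨le_rfl, le_rfl⟩)).2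
  have hSU := (fermiEnergyOf_of_pointBracketCheck truePt_la214SU_x022_br (by norm_num) (by norm_num) (by norm_num) (ν := (39/100 : ℝ)) (by push_cast; exact ⟨le_rfl, le_rfl⟩)).2
  have hQU := (fermiEnergyOf_of_pointBracketCheck truePt_la214QU_x022_br (by norm_num) (by norm_num) (by norm_num) (ν := (39/100 : ℝ)) (by push_cast; exact ⟨le_rfl, le_rfl⟩)).2
  have hTH := (fermiEnergyOf_of_pointBracketCheck truePt_la214TH_x022_br (by norm_num) (by norm_num) (by norm_num) (ν := (39/100 : ℝ)) (by push_cast; exact ⟨le_rfl, le_rfl⟩)).2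
  have hAlo := (fermiEnergyOf_of_pointBracketCheck virtPt_la214Alo_x022_br (by norm_num) (by norm_num) (by norm_num) (ν := (39/100 : ℝ)) (by push_cast; exact ⟨le_rfl, le_rfl⟩)).2
  have hTop := (fermiEnergyOf_of_pointBracketCheck cornerPt_la214BoxHi_x022_br (by norm_num) (by norm_num) (by norm_num) (ν := (39/100 : ℝ)) (by push_cast; exact ⟨le_rfl, le_rfl⟩)).2
  push_cast at hSL hTL hSU hQU hTH hAlo hTop
  norm_num at hSL hTL hSU hQU hTH hAlo hTop
  obtain ⟨hΔl, hΔu⟩ := hΔ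
  obtain ⟨hal, hau⟩ := ha
  constructor
  · have hlow := fsRatio_fermiEnergyOf_trueCorner_lower (Δ₁ := (17 : ℝ) / 10) (a₁ := (129 : ℝ) / 100) (b₁ := (23 : ℝ) / 50) (b₂ := (33 : ℝ) / 50) (c₁ := (3 : ℝ) / 25) (c₂ := (3 : ℝ) / 20)
      (ν := ((39 : ℝ) / 100)) (pL := ((4171 : ℝ) / 2500)) (qL := ((17429 : ℝ) / 10000)) (Mb := ((15901 : ℝ) / 10000)) (Mc := (0 : ℝ)) (by norm_num) hΔl (by norm_num) hal (by norm_num) hb (by norm_num) hc (by norm_num) (by norm_num) (by norm_num)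
      (by norm_num) hSL.1 hAlo.2 (by norm_num) (by norm_num [fsD, fsN]) (by norm_num) (by norm_num) (by norm_num [fsD, fsN]) (by norm_num) (by norm_num [dopingDisc]) (by norm_num [fsD, fsN])
    refine le_trans ?_ hlow
    have hmono := (fsRatio_mem_Icc_on_window_of_dopingDisc_nonpos (Δ := (17 : ℝ) / 10) (a := (129 : ℝ) / 100) (b := (33 : ℝ) / 50) (c := (3 : ℝ) / 20)
      (p := ((17039 : ℝ) / 10000)) (q := ((17139 : ℝ) / 10000)) (by norm_num) (by norm_num) (by norm_num) (by norm_num) (by norm_num) (by norm_num) (by norm_num) (by norm_num [dopingDisc]) hTL).1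
    refine le_trans ?_ hmono
    norm_num [fsRatio, fsD, fsN]
  · have hup := fsRatio_fermiEnergyOf_trueCorner_upper (Δ₁ := (17 : ℝ) / 10) (Δ₂ := 4) (a₁ := (129 : ℝ) / 100) (a₂ := (38 : ℝ) / 25) (b₁ := (23 : ℝ) / 50) (b₂ := (33 : ℝ) / 50) (c₁ := (3 : ℝ) / 25) (c₂ := (3 : ℝ) / 20)
      (ν := ((39 : ℝ) / 100)) (pU := ((14591 : ℝ) / 10000)) (qU := ((15143 : ℝ) / 10000)) (qT := ((21567 : ℝ) / 10000)) (Mb := ((8233 : ℝ) / 2000)) (Mc := (0 : ℝ)) (by norm_num) ⟨hΔl, hΔu⟩ (by norm_num) ⟨hal, hau⟩ (by norm_num) hb (by norm_num) hc (by norm_num) (by norm_num) (by norm_num)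
      hTop.2 (by norm_num) (by norm_num) hSU.1 hQU.2 (by norm_num) (by norm_num [fsD, fsN]) (by norm_num) (by norm_num) (by norm_num [fsD, fsN]) (by norm_num) (by norm_num) (by norm_num [fsD, fsN])
    refine le_trans hup ?_
    have hmono := (fsRatio_mem_Icc_on_window_of_dopingDisc_nonpos (Δ := (4 : ℝ)) (a := (38 : ℝ) / 25) (b := (23 : ℝ) / 50) (c := (3 : ℝ) / 25)
      (p := ((1477 : ℝ) / 1000)) (q := ((1487 : ℝ) / 1000)) (by norm_num) (by norm_num) (by norm_num) (by norm_num) (by norm_num) (by norm_num) (by norm_num) (by norm_num [dopingDisc]) hTH).2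
    refine le_trans hmono ?_
    norm_num [fsRatio, fsD, fsN]

/-- **Box form (x = 1/8): for every member `p` of the typed box `emeryBoxLa214` the one-band Fermi-surface `t′/t` of the σ row at filling 7/16 per spin lies in the
true-corner window.** [folklore] -/
theorem emeryBoxLa214_fsRatio_true_x0125 (p : EmeryCoord → ℝ) (hp : emeryBoxLa214.Mem p) :
    fsRatio (p .DeltaPd) (p .tpd) (p .tpp) (p .tppP) (fermiEnergyOf (p .DeltaPd) (p .tpd) (p .tpp) (p .tppP) ((7 : ℝ) / 16)) ∈ Icc ((-1463 : ℝ) / 5000) ((-1681 : ℝ) / 10000) := by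
  have h := (emeryBoxLa214_mem_iff p).1 hp
  push_cast at h
  obtain ⟨h1, h2, h3, h4, h5, h6, h7, h8, -⟩ := h
  exact la214Box_fsRatio_true_x0125 ⟨by linarith, by linarith⟩ ⟨by linarith, by linarith⟩ ⟨by linarith, by linarith⟩ ⟨by linarith, by linarith⟩

end Summit.Ventures.CertifiedManyBodySolver.Downfold.Emery
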